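import Mathlib
import Literature.Combinatorics.Additive.TripleProductProperty

/-!
# An executable test for the triple product property

`tppCheck S T U : Bool` computes the three right quotient sets `Q(X) = {x y⁻¹}` ONCE (`let`) and checks
that the only `(q₀, q₁) ∈ Q(S) × Q(T)` with `(q₀q₁)⁻¹ ∈ Q(U)` is `(1, 1)` — the quotient-set form of the
triple product property (Cohn–Umans 2003, Def. 2.1).  `tpp_of_tppCheck` turns `tppCheck S T U = true`
(discharged by `native_decide` / `decide`) into `TripleProductProperty S T U`; `tpp_iff_quotient` is
the quotient-set reformulation itself.  Used by the small-`n` census witnesses of the cruxes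
`HyperoctahedralThreshold` / `HyperoctahedralSubsets` / `PolynomialSlack` (explicit TPP triples in
`S_6`, `S_8` whose direct sextuple check is too slow for evaluation).

Reference: H. Cohn, C. Umans, *A group-theoretic approach to fast matrix multiplication*, FOCS 2003,
Def. 2.1 ("for `qᵢ ∈ Q(Sᵢ)`, if `q₁q₂q₃ = 1` then `q₁ = q₂ = q₃ = 1`").
-/

namespace Summit.MatrixMultiplication.MatrixMultiplication.Theorems.HyperoctahedralThreshold.Negative

set_option linter.dupNamespace false

open Literature.Combinatorics.Additive

/-- Quotient-set form of the triple product property (Cohn–Umans 2003, Def. 2.1 as printed: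
"for `qᵢ ∈ Q(Sᵢ)`, if `q₁q₂q₃ = 1` then `q₁ = q₂ = q₃ = 1`", with `Q(S) = {s s'⁻¹}`).
[cite: CohnUmans2003, Def. 2.1] -/
theorem tpp_iff_quotient {G : Type*} [Group G] [DecidableEq G] (S T U : Finset G) :
    TripleProductProperty S T U ↔
      ∀ q₀ ∈ Finset.image₂ (fun a b => a * b⁻¹) S S, ∀ q₁ ∈ Finset.image₂ (fun a b => a * b⁻¹) T T,
        ∀ q₂ ∈ Finset.image₂ (fun a b => a * b⁻¹) U U,
          q₀ * q₁ * q₂ = 1 → q₀ = 1 ∧ q₁ = 1 ∧ q₂ = 1 := by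
  unfold TripleProductProperty
  constructor
  · intro h q₀ hq₀ q₁ hq₁ q₂ hq₂ heq
    obtain ⟨s, hs, s', hs', rfl⟩ := Finset.mem_image₂.1 hq₀
    obtain ⟨t, ht, t', ht', rfl⟩ := Finset.mem_image₂.1 hq₁
    obtain ⟨u, hu, u', hu', rfl⟩ := Finset.mem_image₂.1 hq₂
    obtain ⟨h1, h2, h3⟩ := h s hs s' hs' t ht t' ht' u hu u' hu' heq
    subst h1 h2 h3
    simp
  · intro h s hs s' hs' t ht t' ht' u hu u' hu' heq
    obtain ⟨h1, h2, h3⟩ := h (s * s'⁻¹) (Finset.mem_image₂_of_mem hs hs') (t * t'⁻¹)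
      (Finset.mem_image₂_of_mem ht ht') (u * u'⁻¹) (Finset.mem_image₂_of_mem hu hu') heq
    exact ⟨mul_inv_eq_one.1 h1, mul_inv_eq_one.1 h2, mul_inv_eq_one.1 h3⟩

/-- Executable test for the triple product property: the three quotient sets are computed ONCE
(`let`), and for `q₀ ∈ Q(S)`, `q₁ ∈ Q(T)` the unique candidate `q₂ = (q₀q₁)⁻¹` is looked up in
`Q(U)`. [cite: CohnUmans2003, Def. 2.1] -/
def tppCheck {G : Type*} [Group G] [DecidableEq G] (S T U : Finset G) : Bool :=
  let Q₀ := Finset.image₂ (fun a b => a * b⁻¹) S S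
  let Q₁ := Finset.image₂ (fun a b => a * b⁻¹) T T
  let Q₂ := Finset.image₂ (fun a b => a * b⁻¹) U U
  decide (∀ q₀ ∈ Q₀, ∀ q₁ ∈ Q₁, (q₀ * q₁)⁻¹ ∈ Q₂ → q₀ = 1 ∧ q₁ = 1)

/-- **Soundness of `tppCheck`**: a passing check is the triple product property.
[cite: CohnUmans2003, Def. 2.1] -/
theorem tpp_of_tppCheck {G : Type*} [Group G] [DecidableEq G] {S T U : Finset G}
    (h : tppCheck S T U = true) : TripleProductProperty S T U := by
  rw [tpp_iff_quotient]
  simp only [tppCheck, decide_eq_true_eq] at h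
  intro q₀ hq₀ q₁ hq₁ q₂ hq₂ heq
  have hq : q₂ = (q₀ * q₁)⁻¹ := eq_inv_of_mul_eq_one_right heq
  subst hq
  obtain ⟨h0, h1⟩ := h q₀ hq₀ q₁ hq₁ hq₂
  subst h0 h1
  simp

/-- **Completeness of `tppCheck`**: a triple with the triple product property passes the check.
[cite: CohnUmans2003, Def. 2.1] -/
theorem tppCheck_eq_true {G : Type*} [Group G] [DecidableEq G] {S T U : Finset G}
    (h : TripleProductProperty S T U) : tppCheck S T U = true := by
  rw [tpp_iff_quotient] at h
  simp only [tppCheck, decide_eq_true_eq]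
  intro q₀ hq₀ q₁ hq₁ hq₂
  obtain ⟨h0, h1, -⟩ := h q₀ hq₀ q₁ hq₁ _ hq₂ (by group)
  exact ⟨h0, h1⟩

end Summit.MatrixMultiplication.MatrixMultiplication.Theorems.HyperoctahedralThreshold.Negative
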